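import Summits.AtomisticToContinuum.Crystallization.Theorems.FrustratedLawDichotomyStrainedPatchHomValueT2SoundX

/-!
# (I1) ★★★ `valueLeafT2J_sound` — SOUNDNESS OF THE JOINT-SEGMENT VALUE LEAF (`…HomValueT2KitL` §12, Design J; critic row 1674 (B) (I1) docket of record,
# item 1; 27623 `(H) HomFloor`, hcp half; decomp-a2c hand-1 g49)

If the kernel verdict `valueLeafT2J μ c w` holds for a folded `(U, ξ)`-box `(c, w)` whose centre self-map is within `1/4` of the identity, whose folded
half-widths are at most `1` (`≤ SC` in scaled units), and whose near labels have centre radii off the junction radii `{8/5, 3, 9/2}` of `W₄₅`, then for every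
SELF-ADJOINT `U` and every `ξ` in the box the full two-family `hver` energy is at least `(μ − 1)/SC`.  The `−1` (one unit in the last place, `2⁻⁴⁸`) absorbs
the inner floor division of `accLabel`'s Lipschitz loop (`…SoundT.accLabel_contrib_lip`); every other kit rounding is outward.
Assembly: `Σ_b` of `…SoundV.floorA/floorB` (per-label tangent cubic) + `…SoundW` point memberships into `passP` (`…SoundT.passP_spec`) +
`…SoundD.boxMin_le` + `…SoundH.valueP_sound` + `…SoundS.passJ_spec` + `…SoundT/X` charge comparisons + `…SoundU.of_valueLeafT2J`.

No definitions; 0 sorry; standard axioms; no instances / notation / `#eval`.  `--supports stmt-AtomisticToContinuum-27623`.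
-/

noncomputable section

namespace Summit.AtomisticToContinuum.Crystallization.Theorems.FrustratedLawDichotomyStrainedPatchHomValueT2Kit

open scoped BigOperators RealInnerProductSpace
open Finset
open Literature.Analysis.ValidatedNumerics.Numerics
open Summit.AtomisticToContinuum.Crystallization.Theorems.ChargedEnergyGapNegative (E3)
open Summit.AtomisticToContinuum.Crystallization.Theorems.FrustratedLawDichotomySchurCut (effPot w₄₅ ω₄)
open Summit.AtomisticToContinuum.Crystallization.Theorems.FrustratedLawDichotomyStrainedPatchTaylorLeaves (junctions)
open Summit.AtomisticToContinuum.Crystallization.Theorems.FrustratedLawDichotomyStrainedPatchHomSplit (latPt hexFrame hcpShift)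
open Summit.AtomisticToContinuum.Crystallization.Theorems.FrustratedLawDichotomyStrainedPatchHomEntryGram (cen rad abs_sub_cen_le)
open Summit.AtomisticToContinuum.Crystallization.Theorems.FrustratedLawDichotomyStrainedPatchHomEntryGramHcp (shufFI)
open Summit.AtomisticToContinuum.Crystallization.Theorems.FrustratedLawDichotomyStrainedPatchHomCurvCentreKit (boxE cenE cenX cenMap cenShuf)
open Summit.AtomisticToContinuum.Crystallization.Theorems.FrustratedLawDichotomyStrainedPatchHomCurvLeaf (boxLabels7)

/-! ## §1. The class charge of one label against its `accLabel` contribution -/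

/-- ★ **CLASS CHARGE OF ONE LABEL**: the real value-hull / Lipschitz charge of `label_floor` (displacements `δ0` dominated by `δ`, `|δ_k| ≤ w_k/SC`,
`0 ≤ w_k ≤ SC`) is at most `½·pen0/SC³ + ⅙·(pen6 + 729·SC)/SC³` in terms of the label's `accLabel` contributions (the `729·SC` covers the inner floor
division, one half-width per term of the sorted loop). [folklore chaining: `hull_charge_le`, `lip_charge_le`, `accLabel_contrib_hull/_lip`] -/
theorem charge_le (maskX : Bool) (top : ℕ) (htop : top = (if maskX then 6 else 9)) (blk : ℕ → ℕ → Bool)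
    (hblk : ∀ a b, a < top → b < top → blk a b = true) (wf : Array ℤ) (hw0 : ∀ k, 0 ≤ wf.getD k 0) (hw1 : ∀ k, wf.getD k 0 ≤ (SC : ℤ))
    (Rb : DRec) (Hpt : Array FI) (δ0 δ : ℕ → ℝ) (hδ0 : ∀ k, k < 9 → |δ0 k| ≤ |δ k|) (hδ : ∀ k, k < 9 → |δ k| ≤ ((wf.getD k 0 : ℤ) : ℝ) / SC) :
    1 / 2 * (if Rb.co.lip then 0 else ∑ k ∈ range top, ∑ l ∈ range top, ((max |((hessOf Rb maskX).getD (9 * k + l) fi0).hi - (Hpt.getD (9 * k + l) fi0).lo| |(Hpt.getD (9 * k + l) fi0).hi - ((hessOf Rb maskX).getD (9 * k + l) fi0).lo| : ℤ) : ℝ) / SC * (|δ0 k| * |δ0 l|)) +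
      1 / 6 * (if Rb.co.lip then ∑ a ∈ range top, ∑ b ∈ range top, ∑ m ∈ range top,
        (if a ≤ b ∧ b ≤ m then (if a = b then (if b = m then (1 : ℝ) else 3) else (if b = m then 3 else 6)) *
          ((((thirdOf Rb a b m).absHi : ℤ) : ℝ) / SC * (|δ0 a| * |δ0 b| * |δ0 m|)) else 0) else 0) ≤
      1 / 2 * (((accLabel wJ blk wf Rb Hpt maskX ⟨true, 0, 0⟩).pen0 : ℤ) : ℝ) / ((SC : ℝ) * SC * SC) +
        1 / 6 * ((((accLabel wJ blk wf Rb Hpt maskX ⟨true, 0, 0⟩).pen6 : ℤ) : ℝ) + 729 * SC) / ((SC : ℝ) * SC * SC) := by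
  have hS := SC_pos
  have hS3 : (0 : ℝ) < ((SC : ℝ) * SC * SC) := by positivity
  have htop9 : top ≤ 9 := by rw [htop]; split_ifs <;> norm_num
  have hδ0' : ∀ k, k < 9 → |δ0 k| ≤ ((wf.getD k 0 : ℤ) : ℝ) / SC := fun k hk => (hδ0 k hk).trans (hδ k hk)
  -- the slack: one half-width per term, at most `729·SC`
  have hslack : ∑ _a ∈ range top, ∑ _b ∈ range top, ∑ m ∈ range top, ((wf.getD m 0 : ℤ) : ℝ) ≤ 729 * SC := by
    have h1 : ∑ m ∈ range top, ((wf.getD m 0 : ℤ) : ℝ) ≤ 9 * SC := by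
      calc ∑ m ∈ range top, ((wf.getD m 0 : ℤ) : ℝ) ≤ ∑ _m ∈ range top, (SC : ℝ) := Finset.sum_le_sum fun m _ => by exact_mod_cast hw1 m
        _ = top * SC := by rw [Finset.sum_const, Finset.card_range, nsmul_eq_mul]
        _ ≤ 9 * SC := by have : (top : ℝ) ≤ 9 := by exact_mod_cast htop9
                         nlinarith
    have h2 : ∑ _b ∈ range top, ∑ m ∈ range top, ((wf.getD m 0 : ℤ) : ℝ) ≤ 81 * SC := by
      calc ∑ _b ∈ range top, ∑ m ∈ range top, ((wf.getD m 0 : ℤ) : ℝ) ≤ ∑ _b ∈ range top, (9 * (SC : ℝ)) := Finset.sum_le_sum fun _ _ => h1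
        _ = top * (9 * SC) := by rw [Finset.sum_const, Finset.card_range, nsmul_eq_mul]
        _ ≤ 81 * SC := by have : (top : ℝ) ≤ 9 := by exact_mod_cast htop9
                          nlinarith
    calc ∑ _a ∈ range top, ∑ _b ∈ range top, ∑ m ∈ range top, ((wf.getD m 0 : ℤ) : ℝ) ≤ ∑ _a ∈ range top, (81 * (SC : ℝ)) :=
          Finset.sum_le_sum fun _ _ => h2
      _ = top * (81 * SC) := by rw [Finset.sum_const, Finset.card_range, nsmul_eq_mul]
      _ ≤ 729 * SC := by have : (top : ℝ) ≤ 9 := by exact_mod_cast htop9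
                         nlinarith
  by_cases hl : Rb.co.lip = true
  · -- Lipschitz class
    obtain ⟨hp0, hp6⟩ := accLabel_contrib_lip blk wf Rb Hpt maskX hl hw0
    rw [← htop] at hp6
    have hL := lip_charge_le htop9 Rb (fun k => wf.getD k 0) δ0 hw0 hδ0'
    have hnum : (∑ a ∈ range top, ∑ b ∈ range top, ∑ m ∈ range top,
        (if a ≤ b ∧ b ≤ m then ((wSym wJ a b m : ℤ) : ℝ) * ((thirdOf Rb a b m).absHi : ℝ) * ((wf.getD a 0 : ℤ) : ℝ) * ((wf.getD b 0 : ℤ) : ℝ) *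
          ((wf.getD m 0 : ℤ) : ℝ) / SC else 0)) ≤ (((accLabel wJ blk wf Rb Hpt maskX ⟨true, 0, 0⟩).pen6 : ℤ) : ℝ) + 729 * SC := by
      linarith
    have h3 := hL.trans (div_le_div_of_nonneg_right hnum hS3.le)
    simp only [hl, if_true, mul_zero, zero_add, hp0, Int.cast_zero, zero_div]
    rw [mul_div_assoc]
    exact mul_le_mul_of_nonneg_left h3 (by norm_num)
  · -- value-hull class
    have hl' : Rb.co.lip = false := by simpa using hl
    obtain ⟨hp6, hp0⟩ := accLabel_contrib_hull blk wf Rb Hpt maskX hl'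
    have hH := hull_charge_le htop9
      (fun k l => max |((hessOf Rb maskX).getD (9 * k + l) fi0).hi - (Hpt.getD (9 * k + l) fi0).lo|
        |(Hpt.getD (9 * k + l) fi0).hi - ((hessOf Rb maskX).getD (9 * k + l) fi0).lo|)
      blk (fun k => wf.getD k 0) δ0 (fun a b => le_max_of_le_left (abs_nonneg _)) hw0 hblk hδ0'
    rw [← hp0] at hH
    simp only [hl', Bool.false_eq_true, if_false, mul_zero, add_zero, hp6, Int.cast_zero, zero_add]
    have h729 : (0 : ℝ) ≤ 1 / 6 * (729 * (SC : ℝ)) / ((SC : ℝ) * SC * SC) := by positivity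
    have h1 : 1 / 2 * (∑ k ∈ range top, ∑ l ∈ range top,
        ((max |((hessOf Rb maskX).getD (9 * k + l) fi0).hi - (Hpt.getD (9 * k + l) fi0).lo|
          |(Hpt.getD (9 * k + l) fi0).hi - ((hessOf Rb maskX).getD (9 * k + l) fi0).lo| : ℤ) : ℝ) / SC * (|δ0 k| * |δ0 l|)) ≤
        1 / 2 * (((accLabel wJ blk wf Rb Hpt maskX ⟨true, 0, 0⟩).pen0 : ℤ) : ℝ) / ((SC : ℝ) * SC * SC) := by
      rw [mul_div_assoc]
      exact mul_le_mul_of_nonneg_left hH (by norm_num)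
    linarith

/-! ## §2. ★★★ The theorem -/

/-- ★★★ **SOUNDNESS OF THE JOINT-SEGMENT VALUE LEAF** (`(I1)` for `…HomValueT2KitL.valueLeafT2J`): verdict ⟹ `(μ − 1)/SC ≤ E(U, ξ)` on the whole box,
for self-adjoint `U`. [folklore chaining: parts D, G, H, N–X] -/
theorem valueLeafT2J_sound {μ : ℤ} {c w : (Fin 3 × Fin 3) ⊕ Fin 3 → ℤ} (hleaf : valueLeafT2J μ c w = true)
    (hU1 : ‖cenMap c - 1‖ ≤ 1 / 4) (hw1 : ∀ p : Fin 9, foldW w p ≤ (SC : ℤ))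
    (U : E3 →L[ℝ] E3) (ξ : E3) (hsa : ∀ v v' : E3, ⟪U v, v'⟫ = ⟪v, U v'⟫)
    (hbox : ∀ ab : Fin 3 × Fin 3, |(U (EuclideanSpace.single ab.2 (1 : ℝ))) ab.1 - (c (Sum.inl ab) : ℝ) / SC| ≤ (w (Sum.inl ab) : ℝ) / SC)
    (hξ : ∀ i : Fin 3, |ξ i - (c (Sum.inr i) : ℝ) / SC| ≤ (w (Sum.inr i) : ℝ) / SC)
    (hJA : ∀ b ∈ nearA c w, ‖latPt (cenMap c) hexFrame b‖ ∉ junctions)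
    (hJB : ∀ b ∈ nearB c w, ‖latPt (cenMap c) hexFrame b + cenMap c (hcpShift + cenShuf c)‖ ∉ junctions) :
    ((μ : ℝ) - 1) / SC ≤
      (∑ b ∈ (Fintype.piFinset fun _ : Fin 3 => Finset.Icc (-7 : ℤ) 7).filter (fun b => b ≠ 0), effPot w₄₅ ω₄ (3 / 400) ‖latPt U hexFrame b‖) +
        ∑ b ∈ (Fintype.piFinset fun _ : Fin 3 => Finset.Icc (-7 : ℤ) 7), effPot w₄₅ ω₄ (3 / 400) ‖latPt U hexFrame b + U (hcpShift + ξ)‖ := by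
  classical
  have hS := SC_pos
  have hS3 : (0 : ℝ) < ((SC : ℝ) * SC * SC) := by positivity
  obtain ⟨v, κ, hvP, hκ, hfg, hPok, hAok, hsymOK, hineq⟩ := of_valueLeafT2J hleaf
  obtain ⟨hc, hwpos⟩ := of_foldGuard hfg
  rw [boxSumA_eq_nearSum U hbox, boxSumB_eq_nearSum U hbox ξ hξ]
  -- records of both passes (as functions of the label)
  obtain ⟨hrecA, hrecB, hpen6, hpen0⟩ := passJ_spec c w (Array.ofFn fun p : Fin 9 => foldW w p) (nearA c w) (nearB c w) hAok
  obtain ⟨hPA, hPB, hPH, hPg⟩ := passP_spec c (nearA c w) (nearB c w) hPok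
  obtain ⟨RbA, hRbA⟩ : ∃ RbA : (Fin 3 → ℤ) → DRec, ∀ b ∈ nearA c w, mkDRec 6 (boxE c w) (pA b) = some (RbA b) :=
    ⟨fun b => (mkDRec 6 (boxE c w) (pA b)).getD ⟨fun _ => fi0, #[], #[], #[], ⟨fi0, fi0, fi0, false⟩, #[], #[]⟩, fun b hb => by
      obtain ⟨Rb, Rp, h1, _⟩ := hrecA b hb; simp [h1]⟩
  obtain ⟨RpA, hRpA⟩ : ∃ RpA : (Fin 3 → ℤ) → DRec, ∀ b ∈ nearA c w, mkDRec 6 (cenE c) (pA b) = some (RpA b) :=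
    ⟨fun b => (mkDRec 6 (cenE c) (pA b)).getD ⟨fun _ => fi0, #[], #[], #[], ⟨fi0, fi0, fi0, false⟩, #[], #[]⟩, fun b hb => by
      obtain ⟨Rb, Rp, _, h2⟩ := hrecA b hb; simp [h2]⟩
  obtain ⟨RbB, hRbB⟩ : ∃ RbB : (Fin 3 → ℤ) → DRec, ∀ b ∈ nearB c w, mkDRec 9 (boxE c w) (qB (shufFI c w) b) = some (RbB b) :=
    ⟨fun b => (mkDRec 9 (boxE c w) (qB (shufFI c w) b)).getD ⟨fun _ => fi0, #[], #[], #[], ⟨fi0, fi0, fi0, false⟩, #[], #[]⟩, fun b hb => by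
      obtain ⟨Rb, Rp, h1, _⟩ := hrecB b hb; simp [h1]⟩
  obtain ⟨RpB, hRpB⟩ : ∃ RpB : (Fin 3 → ℤ) → DRec, ∀ b ∈ nearB c w, mkDRec 9 (cenE c) (qB (cenX c) b) = some (RpB b) :=
    ⟨fun b => (mkDRec 9 (cenE c) (qB (cenX c) b)).getD ⟨fun _ => fi0, #[], #[], #[], ⟨fi0, fi0, fi0, false⟩, #[], #[]⟩, fun b hb => by
      obtain ⟨Rb, Rp, _, h2⟩ := hrecB b hb; simp [h2]⟩
  -- half-widths and the folded displacement
  have hwf0 : ∀ k, 0 ≤ (Array.ofFn fun p : Fin 9 => foldW w p).getD k 0 := wfA_nonneg hwpos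
  have hwf1 : ∀ k, (Array.ofFn fun p : Fin 9 => foldW w p).getD k 0 ≤ (SC : ℤ) := wfA_le (by positivity) hw1
  have hδ : ∀ k, k < 9 → |dispN (U - cenMap c) (ξ - cenShuf c) k| ≤ (((Array.ofFn fun p : Fin 9 => foldW w p).getD k 0 : ℤ) : ℝ) / SC :=
    fun k hk => by rw [wfA_getD w hk]; exact abs_dispN_le U ξ hsa hc hbox hξ k hk
  have hδ0 : ∀ k, k < 9 → |dispN (U - cenMap c) 0 k| ≤ |dispN (U - cenMap c) (ξ - cenShuf c) k| := fun k hk => abs_disp0_le _ _ hk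
  -- ★ per-label floors with the class charge in `accLabel` currency, summed over the two families
  have hsumA : ∑ b ∈ (nearA c w).toFinset, (effPot w₄₅ ω₄ (3 / 400) ‖cenMap c (latPt (1 : E3 →L[ℝ] E3) hexFrame b)‖ + deriv (effPot w₄₅ ω₄ (3 / 400)) ‖cenMap c (latPt (1 : E3 →L[ℝ] E3) hexFrame b)‖ / ‖cenMap c (latPt (1 : E3 →L[ℝ] E3) hexFrame b)‖ * ∑ k ∈ range 6, zetaN (cenMap c) (latPt (1 : E3 →L[ℝ] E3) hexFrame b) k * dispN (U - cenMap c) 0 k + 1 / 2 * ∑ k ∈ range 6, ∑ l ∈ range 6, ((deriv (deriv (effPot w₄₅ ω₄ (3 / 400))) ‖cenMap c (latPt (1 : E3 →L[ℝ] E3) hexFrame b)‖ - deriv (effPot w₄₅ ω₄ (3 / 400)) ‖cenMap c (latPt (1 : E3 →L[ℝ] E3) hexFrame b)‖ / ‖cenMap c (latPt (1 : E3 →L[ℝ] E3) hexFrame b)‖) / ‖cenMap c (latPt (1 : E3 →L[ℝ] E3) hexFrame b)‖ ^ 2 * (zetaN (cenMap c) (latPt (1 : E3 →L[ℝ] E3)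 hexFrame b) k * zetaN (cenMap c) (latPt (1 : E3 →L[ℝ] E3) hexFrame b) l) + deriv (effPot w₄₅ ω₄ (3 / 400)) ‖cenMap c (latPt (1 : E3 →L[ℝ] E3) hexFrame b)‖ / ‖cenMap c (latPt (1 : E3 →L[ℝ] E3) hexFrame b)‖ * nuR (cenMap c) (latPt (1 : E3 →L[ℝ] E3) hexFrame b) k l) * (dispN (U - cenMap c) 0 k * dispN (U - cenMap c) 0 l) - (1 / 2 * (((accLabel wJ (fun a b : ℕ => decide (a < 6 ∧ b < 6)) (Array.ofFn fun p : Fin 9 => foldW w p) (RbA b) (hessOf (RpA b) true) true ⟨true, 0, 0⟩).pen0 : ℤ) : ℝ) / ((SC : ℝ) * SC * SC) + 1 / 6 * ((((accLabel wJ (fun a b : ℕ => decide (a < 6 ∧ b < 6)) (Array.ofFn fun p : Fin 9 => foldW w p) (RbA b) (hessOf (RpA b) true) true ⟨true, 0, 0⟩).pen6 : ℤ) : ℝ) + 729 * SC) / ((SC : ℝ) * SC * SC))) ≤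
      ∑ b ∈ (nearA c w).toFinset, effPot w₄₅ ω₄ (3 / 400) ‖latPt U hexFrame b‖ := by
    refine Finset.sum_le_sum fun b hb => ?_
    have hb' := List.mem_toFinset.1 hb
    have h1 := floorA U hsa hc hbox (hRbA b hb') (hRpA b hb') (hJA b hb')
    have h2 := charge_le true 6 (by simp) (fun a b : ℕ => decide (a < 6 ∧ b < 6)) (fun a b ha hb => by simp [ha, hb]) (Array.ofFn fun p : Fin 9 => foldW w p) hwf0 hwf1 (RbA b) (hessOf (RpA b) true)
      (dispN (U - cenMap c) 0) (dispN (U - cenMap c) (ξ - cenShuf c)) hδ0 hδ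
    linarith
  have hsumB : ∑ b ∈ (nearB c w).toFinset, (effPot w₄₅ ω₄ (3 / 400) ‖cenMap c (latPt (1 : E3 →L[ℝ] E3) hexFrame b + (hcpShift + cenShuf c))‖ + deriv (effPot w₄₅ ω₄ (3 / 400)) ‖cenMap c (latPt (1 : E3 →L[ℝ] E3) hexFrame b + (hcpShift + cenShuf c))‖ / ‖cenMap c (latPt (1 : E3 →L[ℝ] E3) hexFrame b + (hcpShift + cenShuf c))‖ * ∑ k ∈ range 9, zetaN (cenMap c) (latPt (1 : E3 →L[ℝ] E3) hexFrame b + (hcpShift + cenShuf c)) k * dispN (U - cenMap c) (ξ - cenShuf c) k + 1 / 2 * ∑ k ∈ range 9, ∑ l ∈ range 9, ((deriv (deriv (effPot w₄₅ ω₄ (3 / 400))) ‖cenMap c (latPt (1 : E3 →L[ℝ] E3) hexFrame b + (hcpShift + cenShuf c))‖ - deriv (effPot w₄₅ ω₄ (3 / 400)) ‖cenMap c (latPt (1 : E3 →L[ℝ] E3) hexFrame b + (hcpShift + cenShuf c))‖ / ‖cenMap c (latPt (1 : E3 →L[ℝ] E3) hexFrame b + (hcpShift + cenShuf c))‖) /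 ‖cenMap c (latPt (1 : E3 →L[ℝ] E3) hexFrame b + (hcpShift + cenShuf c))‖ ^ 2 * (zetaN (cenMap c) (latPt (1 : E3 →L[ℝ] E3) hexFrame b + (hcpShift + cenShuf c)) k * zetaN (cenMap c) (latPt (1 : E3 →L[ℝ] E3) hexFrame b + (hcpShift + cenShuf c)) l) + deriv (effPot w₄₅ ω₄ (3 / 400)) ‖cenMap c (latPt (1 : E3 →L[ℝ] E3) hexFrame b + (hcpShift + cenShuf c))‖ / ‖cenMap c (latPt (1 : E3 →L[ℝ] E3) hexFrame b + (hcpShift + cenShuf c))‖ * nuR (cenMap c) (latPt (1 : E3 →L[ℝ] E3) hexFrame b + (hcpShift + cenShuf c)) k l) * (dispN (U - cenMap c) (ξ - cenShuf c) k * dispN (U - cenMap c) (ξ - cenShuf c) l) - (1 / 2 * (((accLabel wJ (fun _ _ : ℕ => true) (Array.ofFn fun p : Fin 9 => foldW w p) (RbB b) (hessOf (RpB b) false) false ⟨true, 0, 0⟩).pen0 : ℤ) : ℝ) / ((SC : ℝ) * SC * SC) + 1 / 6 * ((((accLabel wJ (fun _ _ : ℕ => true) (Array.ofFn fun p : Fin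 9 => foldW w p) (RbB b) (hessOf (RpB b) false) false ⟨true, 0, 0⟩).pen6 : ℤ) : ℝ) + 729 * SC) / ((SC : ℝ) * SC * SC))) ≤
      ∑ b ∈ (nearB c w).toFinset, effPot w₄₅ ω₄ (3 / 400) ‖latPt U hexFrame b + U (hcpShift + ξ)‖ := by
    refine Finset.sum_le_sum fun b hb => ?_
    have hb' := List.mem_toFinset.1 hb
    have h1 := floorB U ξ hsa hc hbox hξ (hRbB b hb') (hRpB b hb') (hJB b hb')
    have h2 := charge_le false 9 (by simp) (fun _ _ : ℕ => true) (fun _ _ _ _ => rfl) (Array.ofFn fun p : Fin 9 => foldW w p) hwf0 hwf1 (RbB b) (hessOf (RpB b) false)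
      (dispN (U - cenMap c) (ξ - cenShuf c)) (dispN (U - cenMap c) (ξ - cenShuf c)) (fun _ _ => le_rfl) hδ
    linarith
  simp only [Finset.sum_add_distrib, Finset.sum_sub_distrib] at hsumA hsumB
  -- (1) the value at the centre
  have hT1 := centre_energy_ge hvP hU1 hwpos (w := w)
  -- (2) the linear term through the point gradient table
  have hlin : ∑ k ∈ range 9, ((cen ((passP c (nearA c w) (nearB c w)).g.getD k fi0) : ℝ) / SC) * dispN (U - cenMap c) (ξ - cenShuf c) k - ∑ k ∈ range 9, ((rad ((passP c (nearA c w) (nearB c w)).g.getD k fi0) : ℝ) / SC) * |dispN (U - cenMap c) (ξ - cenShuf c) k| ≤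
      (∑ b ∈ (nearA c w).toFinset, deriv (effPot w₄₅ ω₄ (3 / 400)) ‖cenMap c (latPt (1 : E3 →L[ℝ] E3) hexFrame b)‖ / ‖cenMap c (latPt (1 : E3 →L[ℝ] E3) hexFrame b)‖ * ∑ k ∈ range 6, zetaN (cenMap c) (latPt (1 : E3 →L[ℝ] E3) hexFrame b) k * dispN (U - cenMap c) 0 k) + ∑ b ∈ (nearB c w).toFinset, deriv (effPot w₄₅ ω₄ (3 / 400)) ‖cenMap c (latPt (1 : E3 →L[ℝ] E3) hexFrame b + (hcpShift + cenShuf c))‖ / ‖cenMap c (latPt (1 : E3 →L[ℝ] E3) hexFrame b + (hcpShift + cenShuf c))‖ * ∑ k ∈ range 9, zetaN (cenMap c) (latPt (1 : E3 →L[ℝ] E3) hexFrame b + (hcpShift + cenShuf c)) k * dispN (U - cenMap c) (ξ - cenShuf c) k := by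
    have eA : ∀ b : Fin 3 → ℤ, deriv (effPot w₄₅ ω₄ (3 / 400)) ‖cenMap c (latPt (1 : E3 →L[ℝ] E3) hexFrame b)‖ / ‖cenMap c (latPt (1 : E3 →L[ℝ] E3) hexFrame b)‖ * ∑ k ∈ range 6, zetaN (cenMap c) (latPt (1 : E3 →L[ℝ] E3) hexFrame b) k * dispN (U - cenMap c) 0 k = ∑ k ∈ range 9, (if k < 6 then deriv (effPot w₄₅ ω₄ (3 / 400)) ‖cenMap c (latPt (1 : E3 →L[ℝ] E3) hexFrame b)‖ / ‖cenMap c (latPt (1 : E3 →L[ℝ] E3) hexFrame b)‖ * zetaN (cenMap c) (latPt (1 : E3 →L[ℝ] E3) hexFrame b) k else 0) * dispN (U - cenMap c) (ξ - cenShuf c) k := fun b => by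
      rw [Finset.mul_sum, ← sum6_disp0 (U - cenMap c) (ξ - cenShuf c)]
      exact Finset.sum_congr rfl fun k _ => by ring
    have eB : ∀ b : Fin 3 → ℤ, deriv (effPot w₄₅ ω₄ (3 / 400)) ‖cenMap c (latPt (1 : E3 →L[ℝ] E3) hexFrame b + (hcpShift + cenShuf c))‖ / ‖cenMap c (latPt (1 : E3 →L[ℝ] E3) hexFrame b + (hcpShift + cenShuf c))‖ * ∑ k ∈ range 9, zetaN (cenMap c) (latPt (1 : E3 →L[ℝ] E3) hexFrame b + (hcpShift + cenShuf c)) k * dispN (U - cenMap c) (ξ - cenShuf c) k = ∑ k ∈ range 9, (deriv (effPot w₄₅ ω₄ (3 / 400)) ‖cenMap c (latPt (1 : E3 →L[ℝ] E3) hexFrame b + (hcpShift + cenShuf c))‖ / ‖cenMap c (latPt (1 : E3 →L[ℝ] E3) hexFrame b + (hcpShift + cenShuf c))‖ * zetaN (cenMap c) (latPt (1 : E3 →L[ℝ] E3) hexFrame b + (hcpShift + cenShuf c)) k) * dispN (U - cenMap c) (ξ - cenShuf c) k := fun b => by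
      rw [Finset.mul_sum]
      exact Finset.sum_congr rfl fun k _ => by ring
    simp only [eA, eB]
    rw [Finset.sum_comm (s := (nearA c w).toFinset) (t := range 9), Finset.sum_comm (s := (nearB c w).toFinset) (t := range 9),
      ← Finset.sum_add_distrib]
    have e3 : ∀ k ∈ range 9, (∑ b ∈ (nearA c w).toFinset, (if k < 6 then deriv (effPot w₄₅ ω₄ (3 / 400)) ‖cenMap c (latPt (1 : E3 →L[ℝ] E3) hexFrame b)‖ / ‖cenMap c (latPt (1 : E3 →L[ℝ] E3) hexFrame b)‖ * zetaN (cenMap c) (latPt (1 : E3 →L[ℝ] E3) hexFrame b) k else 0) * dispN (U - cenMap c) (ξ - cenShuf c) k) +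
        ∑ b ∈ (nearB c w).toFinset, (deriv (effPot w₄₅ ω₄ (3 / 400)) ‖cenMap c (latPt (1 : E3 →L[ℝ] E3) hexFrame b + (hcpShift + cenShuf c))‖ / ‖cenMap c (latPt (1 : E3 →L[ℝ] E3) hexFrame b + (hcpShift + cenShuf c))‖ * zetaN (cenMap c) (latPt (1 : E3 →L[ℝ] E3) hexFrame b + (hcpShift + cenShuf c)) k) * dispN (U - cenMap c) (ξ - cenShuf c) k =
        ((∑ b ∈ (nearA c w).toFinset, (if k < 6 then deriv (effPot w₄₅ ω₄ (3 / 400)) ‖cenMap c (latPt (1 : E3 →L[ℝ] E3) hexFrame b)‖ / ‖cenMap c (latPt (1 : E3 →L[ℝ] E3) hexFrame b)‖ * zetaN (cenMap c) (latPt (1 : E3 →L[ℝ] E3) hexFrame b) k else 0)) +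
          ∑ b ∈ (nearB c w).toFinset, deriv (effPot w₄₅ ω₄ (3 / 400)) ‖cenMap c (latPt (1 : E3 →L[ℝ] E3) hexFrame b + (hcpShift + cenShuf c))‖ / ‖cenMap c (latPt (1 : E3 →L[ℝ] E3) hexFrame b + (hcpShift + cenShuf c))‖ * zetaN (cenMap c) (latPt (1 : E3 →L[ℝ] E3) hexFrame b + (hcpShift + cenShuf c)) k) * dispN (U - cenMap c) (ξ - cenShuf c) k := fun k _ => by
      rw [add_mul, Finset.sum_mul, Finset.sum_mul]
    rw [Finset.sum_congr rfl e3]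
    refine sum_lin_bound _ _ (fun k => (passP c (nearA c w) (nearB c w)).g.getD k fi0) fun k hk => ?_
    have hm := hPg k hk (fun b => if k < 6 then deriv (effPot w₄₅ ω₄ (3 / 400)) ‖cenMap c (latPt (1 : E3 →L[ℝ] E3) hexFrame b)‖ / ‖cenMap c (latPt (1 : E3 →L[ℝ] E3) hexFrame b)‖ * zetaN (cenMap c) (latPt (1 : E3 →L[ℝ] E3) hexFrame b) k else 0) (fun b => deriv (effPot w₄₅ ω₄ (3 / 400)) ‖cenMap c (latPt (1 : E3 →L[ℝ] E3) hexFrame b + (hcpShift + cenShuf c))‖ / ‖cenMap c (latPt (1 : E3 →L[ℝ] E3) hexFrame b + (hcpShift + cenShuf c))‖ * zetaN (cenMap c) (latPt (1 : E3 →L[ℝ] E3) hexFrame b + (hcpShift + cenShuf c)) k)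
      (fun b hb R hR => (ptA_mem c hR (hJA b hb)).1 k hk) (fun b hb R hR => (ptB_mem c hR (hJB b hb)).1 k hk)
    rw [← List.sum_toFinset _ (nearA_nodup c w), ← List.sum_toFinset _ (nearB_nodup c w)] at hm
    exact hm
  -- (3) the quadratic term through the point Hessian table
  have hquad : 1 / 2 * (∑ k ∈ range 9, ∑ l ∈ range 9, ((cen ((passP c (nearA c w) (nearB c w)).H.getD (9 * k + l) fi0) : ℝ) / SC) * (dispN (U - cenMap c) (ξ - cenShuf c) k * dispN (U - cenMap c) (ξ - cenShuf c) l) -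
      ∑ k ∈ range 9, ∑ l ∈ range 9, ((rad ((passP c (nearA c w) (nearB c w)).H.getD (9 * k + l) fi0) : ℝ) / SC) * (|dispN (U - cenMap c) (ξ - cenShuf c) k| * |dispN (U - cenMap c) (ξ - cenShuf c) l|)) ≤
      (∑ b ∈ (nearA c w).toFinset, 1 / 2 * ∑ k ∈ range 6, ∑ l ∈ range 6, ((deriv (deriv (effPot w₄₅ ω₄ (3 / 400))) ‖cenMap c (latPt (1 : E3 →L[ℝ] E3) hexFrame b)‖ - deriv (effPot w₄₅ ω₄ (3 / 400)) ‖cenMap c (latPt (1 : E3 →L[ℝ] E3) hexFrame b)‖ / ‖cenMap c (latPt (1 : E3 →L[ℝ] E3) hexFrame b)‖) / ‖cenMap c (latPt (1 : E3 →L[ℝ] E3) hexFrame b)‖ ^ 2 * (zetaN (cenMap c) (latPt (1 : E3 →L[ℝ] E3) hexFrame b) k * zetaN (cenMap c) (latPt (1 : E3 →L[ℝ] E3) hexFrame b) l) + deriv (effPot w₄₅ ω₄ (3 / 400)) ‖cenMap c (latPt (1 : E3 →L[ℝ] E3) hexFrame b)‖ / ‖cenMap c (latPt (1 : E3 →L[ℝ]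 E3) hexFrame b)‖ * nuR (cenMap c) (latPt (1 : E3 →L[ℝ] E3) hexFrame b) k l) * (dispN (U - cenMap c) 0 k * dispN (U - cenMap c) 0 l)) + ∑ b ∈ (nearB c w).toFinset, 1 / 2 * ∑ k ∈ range 9, ∑ l ∈ range 9, ((deriv (deriv (effPot w₄₅ ω₄ (3 / 400))) ‖cenMap c (latPt (1 : E3 →L[ℝ] E3) hexFrame b + (hcpShift + cenShuf c))‖ - deriv (effPot w₄₅ ω₄ (3 / 400)) ‖cenMap c (latPt (1 : E3 →L[ℝ] E3) hexFrame b + (hcpShift + cenShuf c))‖ / ‖cenMap c (latPt (1 : E3 →L[ℝ] E3) hexFrame b + (hcpShift + cenShuf c))‖) / ‖cenMap c (latPt (1 : E3 →L[ℝ] E3) hexFrame b + (hcpShift + cenShuf c))‖ ^ 2 * (zetaN (cenMap c) (latPt (1 : E3 →L[ℝ] E3) hexFrame b + (hcpShift + cenShuf c)) k * zetaN (cenMap c) (latPt (1 : E3 →L[ℝ] E3) hexFrame b + (hcpShift + cenShuf c)) l) + deriv (effPot w₄₅ ω₄ (3 / 400)) ‖cenMap c (latPt (1 : E3 →L[ℝ]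 E3) hexFrame b + (hcpShift + cenShuf c))‖ / ‖cenMap c (latPt (1 : E3 →L[ℝ] E3) hexFrame b + (hcpShift + cenShuf c))‖ * nuR (cenMap c) (latPt (1 : E3 →L[ℝ] E3) hexFrame b + (hcpShift + cenShuf c)) k l) * (dispN (U - cenMap c) (ξ - cenShuf c) k * dispN (U - cenMap c) (ξ - cenShuf c) l) := by
    have eA : ∀ b : Fin 3 → ℤ, ∑ k ∈ range 6, ∑ l ∈ range 6, ((deriv (deriv (effPot w₄₅ ω₄ (3 / 400))) ‖cenMap c (latPt (1 : E3 →L[ℝ] E3) hexFrame b)‖ - deriv (effPot w₄₅ ω₄ (3 / 400)) ‖cenMap c (latPt (1 : E3 →L[ℝ] E3) hexFrame b)‖ / ‖cenMap c (latPt (1 : E3 →L[ℝ] E3) hexFrame b)‖) / ‖cenMap c (latPt (1 : E3 →L[ℝ] E3) hexFrame b)‖ ^ 2 * (zetaN (cenMap c) (latPt (1 : E3 →L[ℝ] E3) hexFrame b) k * zetaN (cenMap c) (latPt (1 : E3 →L[ℝ] E3) hexFrame b) l) + deriv (effPot w₄₅ ω₄ (3 / 400)) ‖cenMap c (latPt (1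 : E3 →L[ℝ] E3) hexFrame b)‖ / ‖cenMap c (latPt (1 : E3 →L[ℝ] E3) hexFrame b)‖ * nuR (cenMap c) (latPt (1 : E3 →L[ℝ] E3) hexFrame b) k l) * (dispN (U - cenMap c) 0 k * dispN (U - cenMap c) 0 l) =
        ∑ k ∈ range 9, ∑ l ∈ range 9, (if k < 6 ∧ l < 6 then ((deriv (deriv (effPot w₄₅ ω₄ (3 / 400))) ‖cenMap c (latPt (1 : E3 →L[ℝ] E3) hexFrame b)‖ - deriv (effPot w₄₅ ω₄ (3 / 400)) ‖cenMap c (latPt (1 : E3 →L[ℝ] E3) hexFrame b)‖ / ‖cenMap c (latPt (1 : E3 →L[ℝ] E3) hexFrame b)‖) / ‖cenMap c (latPt (1 : E3 →L[ℝ] E3) hexFrame b)‖ ^ 2 * (zetaN (cenMap c) (latPt (1 : E3 →L[ℝ] E3) hexFrame b) k * zetaN (cenMap c) (latPt (1 : E3 →L[ℝ] E3) hexFrame b) l) + deriv (effPot w₄₅ ω₄ (3 / 400)) ‖cenMap c (latPt (1 : E3 →L[ℝ] E3) hexFrame b)‖ / ‖cenMap c (latPt (1 : E3 →L[ℝ]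 E3) hexFrame b)‖ * nuR (cenMap c) (latPt (1 : E3 →L[ℝ] E3) hexFrame b) k l) else 0) * (dispN (U - cenMap c) (ξ - cenShuf c) k * dispN (U - cenMap c) (ξ - cenShuf c) l) := fun b =>
      sum66_disp0 (U - cenMap c) (ξ - cenShuf c) _
    simp only [eA]
    rw [← Finset.mul_sum, ← Finset.mul_sum, ← mul_add]
    refine mul_le_mul_of_nonneg_left ?_ (by norm_num)
    rw [Finset.sum_comm (s := (nearA c w).toFinset) (t := range 9), Finset.sum_comm (s := (nearB c w).toFinset) (t := range 9),
      ← Finset.sum_add_distrib]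
    have e3 : ∀ k ∈ range 9, (∑ b ∈ (nearA c w).toFinset, ∑ l ∈ range 9, (if k < 6 ∧ l < 6 then ((deriv (deriv (effPot w₄₅ ω₄ (3 / 400))) ‖cenMap c (latPt (1 : E3 →L[ℝ] E3) hexFrame b)‖ - deriv (effPot w₄₅ ω₄ (3 / 400)) ‖cenMap c (latPt (1 : E3 →L[ℝ] E3) hexFrame b)‖ / ‖cenMap c (latPt (1 : E3 →L[ℝ] E3) hexFrame b)‖) / ‖cenMap c (latPt (1 : E3 →L[ℝ] E3) hexFrame b)‖ ^ 2 * (zetaN (cenMap c) (latPt (1 : E3 →L[ℝ] E3) hexFrame b) k * zetaN (cenMap c) (latPt (1 : E3 →L[ℝ] E3) hexFrame b) l) + deriv (effPot w₄₅ ω₄ (3 / 400)) ‖cenMap c (latPt (1 : E3 →L[ℝ] E3) hexFrame b)‖ / ‖cenMap c (latPt (1 : E3 →L[ℝ] E3) hexFrame b)‖ * nuR (cenMap c) (latPt (1 : E3 →L[ℝ] E3) hexFrame b) k l) else 0) * (dispN (U - cenMap c) (ξ - cenShuf c) k * dispN (U - cenMap c) (ξ - cenShuf c) l)) +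
        ∑ b ∈ (nearB c w).toFinset, ∑ l ∈ range 9, ((deriv (deriv (effPot w₄₅ ω₄ (3 / 400))) ‖cenMap c (latPt (1 : E3 →L[ℝ] E3) hexFrame b + (hcpShift + cenShuf c))‖ - deriv (effPot w₄₅ ω₄ (3 / 400)) ‖cenMap c (latPt (1 : E3 →L[ℝ] E3) hexFrame b + (hcpShift + cenShuf c))‖ / ‖cenMap c (latPt (1 : E3 →L[ℝ] E3) hexFrame b + (hcpShift + cenShuf c))‖) / ‖cenMap c (latPt (1 : E3 →L[ℝ] E3) hexFrame b + (hcpShift + cenShuf c))‖ ^ 2 * (zetaN (cenMap c) (latPt (1 : E3 →L[ℝ] E3) hexFrame b + (hcpShift + cenShuf c)) k * zetaN (cenMap c) (latPt (1 : E3 →L[ℝ] E3) hexFrame b + (hcpShift + cenShuf c)) l) + deriv (effPot w₄₅ ω₄ (3 / 400)) ‖cenMap c (latPt (1 : E3 →L[ℝ] E3) hexFrame b + (hcpShift + cenShuf c))‖ / ‖cenMap c (latPt (1 : E3 →L[ℝ] E3) hexFrame b + (hcpShift + cenShuf c))‖ * nuR (cenMap c) (latPt (1 : E3 →L[ℝ]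 E3) hexFrame b + (hcpShift + cenShuf c)) k l) * (dispN (U - cenMap c) (ξ - cenShuf c) k * dispN (U - cenMap c) (ξ - cenShuf c) l) =
        ∑ l ∈ range 9, ((∑ b ∈ (nearA c w).toFinset, (if k < 6 ∧ l < 6 then ((deriv (deriv (effPot w₄₅ ω₄ (3 / 400))) ‖cenMap c (latPt (1 : E3 →L[ℝ] E3) hexFrame b)‖ - deriv (effPot w₄₅ ω₄ (3 / 400)) ‖cenMap c (latPt (1 : E3 →L[ℝ] E3) hexFrame b)‖ / ‖cenMap c (latPt (1 : E3 →L[ℝ] E3) hexFrame b)‖) / ‖cenMap c (latPt (1 : E3 →L[ℝ] E3) hexFrame b)‖ ^ 2 * (zetaN (cenMap c) (latPt (1 : E3 →L[ℝ] E3) hexFrame b) k * zetaN (cenMap c) (latPt (1 : E3 →L[ℝ] E3) hexFrame b) l) + deriv (effPot w₄₅ ω₄ (3 / 400)) ‖cenMap c (latPt (1 : E3 →L[ℝ] E3) hexFrame b)‖ / ‖cenMap c (latPt (1 : E3 →L[ℝ] E3) hexFrame b)‖ * nuR (cenMap c) (latPt (1 : E3 →L[ℝ] E3) hexFrame b) k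 l) else 0)) +
          ∑ b ∈ (nearB c w).toFinset, ((deriv (deriv (effPot w₄₅ ω₄ (3 / 400))) ‖cenMap c (latPt (1 : E3 →L[ℝ] E3) hexFrame b + (hcpShift + cenShuf c))‖ - deriv (effPot w₄₅ ω₄ (3 / 400)) ‖cenMap c (latPt (1 : E3 →L[ℝ] E3) hexFrame b + (hcpShift + cenShuf c))‖ / ‖cenMap c (latPt (1 : E3 →L[ℝ] E3) hexFrame b + (hcpShift + cenShuf c))‖) / ‖cenMap c (latPt (1 : E3 →L[ℝ] E3) hexFrame b + (hcpShift + cenShuf c))‖ ^ 2 * (zetaN (cenMap c) (latPt (1 : E3 →L[ℝ] E3) hexFrame b + (hcpShift + cenShuf c)) k * zetaN (cenMap c) (latPt (1 : E3 →L[ℝ] E3) hexFrame b + (hcpShift + cenShuf c)) l) + deriv (effPot w₄₅ ω₄ (3 / 400)) ‖cenMap c (latPt (1 : E3 →L[ℝ] E3) hexFrame b + (hcpShift + cenShuf c))‖ / ‖cenMap c (latPt (1 : E3 →L[ℝ] E3) hexFrame b + (hcpShift + cenShuf c))‖ * nuR (cenMap c) (latPt (1 : E3 →L[ℝ] E3)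 hexFrame b + (hcpShift + cenShuf c)) k l)) * (dispN (U - cenMap c) (ξ - cenShuf c) k * dispN (U - cenMap c) (ξ - cenShuf c) l) := fun k _ => by
      rw [Finset.sum_comm (s := (nearA c w).toFinset) (t := range 9), Finset.sum_comm (s := (nearB c w).toFinset) (t := range 9),
        ← Finset.sum_add_distrib]
      exact Finset.sum_congr rfl fun l _ => by rw [add_mul, Finset.sum_mul, Finset.sum_mul]
    rw [Finset.sum_congr rfl e3]
    refine sum_quad_bound _ _ (fun k l => (passP c (nearA c w) (nearB c w)).H.getD (9 * k + l) fi0) fun k l hk hl => ?_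
    have hm := hPH (9 * k + l) (by omega)
      (fun b => if k < 6 ∧ l < 6 then ((deriv (deriv (effPot w₄₅ ω₄ (3 / 400))) ‖cenMap c (latPt (1 : E3 →L[ℝ] E3) hexFrame b)‖ - deriv (effPot w₄₅ ω₄ (3 / 400)) ‖cenMap c (latPt (1 : E3 →L[ℝ] E3) hexFrame b)‖ / ‖cenMap c (latPt (1 : E3 →L[ℝ] E3) hexFrame b)‖) / ‖cenMap c (latPt (1 : E3 →L[ℝ] E3) hexFrame b)‖ ^ 2 * (zetaN (cenMap c) (latPt (1 : E3 →L[ℝ] E3) hexFrame b) k * zetaN (cenMap c) (latPt (1 : E3 →L[ℝ] E3) hexFrame b) l) + deriv (effPot w₄₅ ω₄ (3 / 400)) ‖cenMap c (latPt (1 : E3 →L[ℝ] E3) hexFrame b)‖ / ‖cenMap c (latPt (1 : E3 →L[ℝ] E3) hexFrame b)‖ * nuR (cenMap c) (latPt (1 : E3 →L[ℝ] E3) hexFrame b) k l) else 0) (fun b => ((deriv (deriv (effPot w₄₅ ω₄ (3 / 400))) ‖cenMap c (latPt (1 : E3 →L[ℝ] E3) hexFrame b + (hcpShift + cenShuf c))‖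 - deriv (effPot w₄₅ ω₄ (3 / 400)) ‖cenMap c (latPt (1 : E3 →L[ℝ] E3) hexFrame b + (hcpShift + cenShuf c))‖ / ‖cenMap c (latPt (1 : E3 →L[ℝ] E3) hexFrame b + (hcpShift + cenShuf c))‖) / ‖cenMap c (latPt (1 : E3 →L[ℝ] E3) hexFrame b + (hcpShift + cenShuf c))‖ ^ 2 * (zetaN (cenMap c) (latPt (1 : E3 →L[ℝ] E3) hexFrame b + (hcpShift + cenShuf c)) k * zetaN (cenMap c) (latPt (1 : E3 →L[ℝ] E3) hexFrame b + (hcpShift + cenShuf c)) l) + deriv (effPot w₄₅ ω₄ (3 / 400)) ‖cenMap c (latPt (1 : E3 →L[ℝ] E3) hexFrame b + (hcpShift + cenShuf c))‖ / ‖cenMap c (latPt (1 : E3 →L[ℝ] E3) hexFrame b + (hcpShift + cenShuf c))‖ * nuR (cenMap c) (latPt (1 : E3 →L[ℝ] E3) hexFrame b + (hcpShift + cenShuf c)) k l))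
      (fun b hb R hR => (ptA_mem c hR (hJA b hb)).2 k l hk hl) (fun b hb R hR => (ptB_mem c hR (hJB b hb)).2 k l hk hl)
    rw [← List.sum_toFinset _ (nearA_nodup c w), ← List.sum_toFinset _ (nearB_nodup c w)] at hm
    exact hm
  -- (4) the certified box minimum
  have hbm := boxMin_le ((passP c (nearA c w) (nearB c w)).H.map cen) ((passP c (nearA c w) (nearB c w)).g.map cen) (Array.ofFn fun p : Fin 9 => foldW w p) (anchor ((passP c (nearA c w) (nearB c w)).H.map cen) ((passP c (nearA c w) (nearB c w)).g.map cen) (Array.ofFn fun p : Fin 9 => foldW w p) 40) κ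
    (sym_of_symOK hsymOK) (psd_of_kappaShift hκ) (dispN (U - cenMap c) (ξ - cenShuf c)) hδ
  simp only [get81, getD_map_cen] at hbm
  -- (5) the point-width penalties
  have hr1 : ∀ k, k < 9 → 0 ≤ rad ((passP c (nearA c w) (nearB c w)).g.getD k fi0) := fun k hk => by
    have hm := hPg k hk (fun b => if k < 6 then deriv (effPot w₄₅ ω₄ (3 / 400)) ‖cenMap c (latPt (1 : E3 →L[ℝ] E3) hexFrame b)‖ / ‖cenMap c (latPt (1 : E3 →L[ℝ] E3) hexFrame b)‖ * zetaN (cenMap c) (latPt (1 : E3 →L[ℝ] E3) hexFrame b) k else 0) (fun b => deriv (effPot w₄₅ ω₄ (3 / 400)) ‖cenMap c (latPt (1 : E3 →L[ℝ] E3) hexFrame b + (hcpShift + cenShuf c))‖ / ‖cenMap c (latPt (1 : E3 →L[ℝ] E3) hexFrame b + (hcpShift + cenShuf c))‖ * zetaN (cenMap c) (latPt (1 : E3 →L[ℝ] E3) hexFrame b + (hcpShift + cenShuf c)) k)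
      (fun b hb R hR => (ptA_mem c hR (hJA b hb)).1 k hk) (fun b hb R hR => (ptB_mem c hR (hJB b hb)).1 k hk)
    exact rad_nonneg hm
  have hr2 : ∀ k l, k < 9 → l < 9 → 0 ≤ rad ((passP c (nearA c w) (nearB c w)).H.getD (9 * k + l) fi0) := fun k l hk hl => by
    have hm := hPH (9 * k + l) (by omega)
      (fun b => if k < 6 ∧ l < 6 then ((deriv (deriv (effPot w₄₅ ω₄ (3 / 400))) ‖cenMap c (latPt (1 : E3 →L[ℝ] E3) hexFrame b)‖ - deriv (effPot w₄₅ ω₄ (3 / 400)) ‖cenMap c (latPt (1 : E3 →L[ℝ] E3) hexFrame b)‖ / ‖cenMap c (latPt (1 : E3 →L[ℝ] E3) hexFrame b)‖) / ‖cenMap c (latPt (1 : E3 →L[ℝ] E3) hexFrame b)‖ ^ 2 * (zetaN (cenMap c) (latPt (1 : E3 →L[ℝ] E3) hexFrame b) k * zetaN (cenMap c) (latPt (1 : E3 →L[ℝ] E3) hexFrame b) l) + deriv (effPot w₄₅ ω₄ (3 / 400)) ‖cenMap c (latPt (1 : E3 →L[ℝ] E3) hexFrame b)‖ / ‖cenMap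 c (latPt (1 : E3 →L[ℝ] E3) hexFrame b)‖ * nuR (cenMap c) (latPt (1 : E3 →L[ℝ] E3) hexFrame b) k l) else 0) (fun b => ((deriv (deriv (effPot w₄₅ ω₄ (3 / 400))) ‖cenMap c (latPt (1 : E3 →L[ℝ] E3) hexFrame b + (hcpShift + cenShuf c))‖ - deriv (effPot w₄₅ ω₄ (3 / 400)) ‖cenMap c (latPt (1 : E3 →L[ℝ] E3) hexFrame b + (hcpShift + cenShuf c))‖ / ‖cenMap c (latPt (1 : E3 →L[ℝ] E3) hexFrame b + (hcpShift + cenShuf c))‖) / ‖cenMap c (latPt (1 : E3 →L[ℝ] E3) hexFrame b + (hcpShift + cenShuf c))‖ ^ 2 * (zetaN (cenMap c) (latPt (1 : E3 →L[ℝ] E3) hexFrame b + (hcpShift + cenShuf c)) k * zetaN (cenMap c) (latPt (1 : E3 →L[ℝ] E3) hexFrame b + (hcpShift + cenShuf c)) l) + deriv (effPot w₄₅ ω₄ (3 / 400)) ‖cenMap c (latPt (1 : E3 →L[ℝ] E3) hexFrame b + (hcpShift + cenShuf c))‖ / ‖cenMap c (latPt (1 : E3 →L[ℝ] E3) hexFrame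 b + (hcpShift + cenShuf c))‖ * nuR (cenMap c) (latPt (1 : E3 →L[ℝ] E3) hexFrame b + (hcpShift + cenShuf c)) k l))
      (fun b hb R hR => (ptA_mem c hR (hJA b hb)).2 k l hk hl) (fun b hb R hR => (ptB_mem c hR (hJB b hb)).2 k l hk hl)
    exact rad_nonneg hm
  have hpen1 := pen1_bound (fun k => rad ((passP c (nearA c w) (nearB c w)).g.getD k fi0)) (fun k => (Array.ofFn fun p : Fin 9 => foldW w p).getD k 0) (dispN (U - cenMap c) (ξ - cenShuf c)) hr1 hδ
  have hpen2 := pen2_bound (fun k l => rad ((passP c (nearA c w) (nearB c w)).H.getD (9 * k + l) fi0)) (fun k => (Array.ofFn fun p : Fin 9 => foldW w p).getD k 0) (dispN (U - cenMap c) (ξ - cenShuf c)) hr2 hδ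
  -- the kit's folds are these sums
  have ec1 : ((List.range 9).foldl (fun s k => s + ((passP c (nearA c w) (nearB c w)).g.map rad).getD k 0 * (Array.ofFn fun p : Fin 9 => foldW w p).getD k 0) 0) = (∑ k ∈ range 9, rad ((passP c (nearA c w) (nearB c w)).g.getD k fi0) * (Array.ofFn fun p : Fin 9 => foldW w p).getD k 0) := by
    rw [foldl9_sum]; simp only [getD_map_rad]
  have ec2 : ((List.range 9).foldl (fun s k => (List.range 9).foldl (fun s2 l => s2 + (((passP c (nearA c w) (nearB c w)).H.map rad).getD (9 * k + l) 0) * (Array.ofFn fun p : Fin 9 => foldW w p).getD k 0 * (Array.ofFn fun p : Fin 9 => foldW w p).getD l 0) s) 0) = (∑ k ∈ range 9, ∑ l ∈ range 9, rad ((passP c (nearA c w) (nearB c w)).H.getD (9 * k + l) fi0) * (Array.ofFn fun p : Fin 9 => foldW w p).getD k 0 * (Array.ofFn fun p : Fin 9 => foldW w p).getD l 0) := by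
    rw [foldl99_sum]; simp only [getD_map_rad]
  have ec1R : (((∑ k ∈ range 9, rad ((passP c (nearA c w) (nearB c w)).g.getD k fi0) * (Array.ofFn fun p : Fin 9 => foldW w p).getD k 0) : ℤ) : ℝ) = ((((List.range 9).foldl (fun s k => s + ((passP c (nearA c w) (nearB c w)).g.map rad).getD k 0 * (Array.ofFn fun p : Fin 9 => foldW w p).getD k 0) 0) : ℤ) : ℝ) := by rw [ec1]
  have ec2R : (((∑ k ∈ range 9, ∑ l ∈ range 9, rad ((passP c (nearA c w) (nearB c w)).H.getD (9 * k + l) fi0) * (Array.ofFn fun p : Fin 9 => foldW w p).getD k 0 * (Array.ofFn fun p : Fin 9 => foldW w p).getD l 0) : ℤ) : ℝ) = ((((List.range 9).foldl (fun s k => (List.range 9).foldl (fun s2 l => s2 + (((passP c (nearA c w) (nearB c w)).H.map rad).getD (9 * k + l) 0) * (Array.ofFn fun p : Fin 9 => foldW w p).getD k 0 * (Array.ofFn fun p : Fin 9 => foldW w p).getD l 0) s) 0) : ℤ) : ℝ) := by rw [ec2]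
  have hc1 := div_le_cdiv (a := ((List.range 9).foldl (fun s k => s + ((passP c (nearA c w) (nearB c w)).g.map rad).getD k 0 * (Array.ofFn fun p : Fin 9 => foldW w p).getD k 0) 0)) (b := (SC : ℤ)) SCZ_pos
  have hc2 := div_le_cdiv (a := ((List.range 9).foldl (fun s k => (List.range 9).foldl (fun s2 l => s2 + (((passP c (nearA c w) (nearB c w)).H.map rad).getD (9 * k + l) 0) * (Array.ofFn fun p : Fin 9 => foldW w p).getD k 0 * (Array.ofFn fun p : Fin 9 => foldW w p).getD l 0) s) 0)) (b := 2 * (SC : ℤ) * (SC : ℤ)) (mul_pos (mul_pos (by norm_num) SCZ_pos) SCZ_pos)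
  have hc3 := div_le_cdiv (a := (passJ c w (Array.ofFn fun p : Fin 9 => foldW w p) (nearA c w) (nearB c w)).pen6) (b := 6 * (SC : ℤ) * (SC : ℤ)) (mul_pos (mul_pos (by norm_num) SCZ_pos) SCZ_pos)
  have hc4 := div_le_cdiv (a := (passJ c w (Array.ofFn fun p : Fin 9 => foldW w p) (nearA c w) (nearB c w)).pen0) (b := 2 * (SC : ℤ) * (SC : ℤ)) (mul_pos (mul_pos (by norm_num) SCZ_pos) SCZ_pos)
  -- (6) `pen0` / `pen6` as the sums of the per-label contributions
  have ep0 : (passJ c w (Array.ofFn fun p : Fin 9 => foldW w p) (nearA c w) (nearB c w)).pen0 = (∑ b ∈ (nearA c w).toFinset, (accLabel wJ (fun a b : ℕ => decide (a < 6 ∧ b < 6)) (Array.ofFn fun p : Fin 9 => foldW w p) (RbA b) (hessOf (RpA b) true) true ⟨true, 0, 0⟩).pen0) + ∑ b ∈ (nearB c w).toFinset, (accLabel wJ (fun _ _ : ℕ => true) (Array.ofFn fun p : Fin 9 => foldW w p) (RbB b) (hessOf (RpB b) false) false ⟨true, 0, 0⟩).pen0 := by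
    rw [hpen0, List.sum_toFinset _ (nearA_nodup c w), List.sum_toFinset _ (nearB_nodup c w)]
    exact congrArg₂ (· + ·) (congrArg List.sum (List.map_congr_left fun b hb => by simp only [hRbA b hb, hRpA b hb]))
      (congrArg List.sum (List.map_congr_left fun b hb => by simp only [hRbB b hb, hRpB b hb]))
  have ep6 : (passJ c w (Array.ofFn fun p : Fin 9 => foldW w p) (nearA c w) (nearB c w)).pen6 = (∑ b ∈ (nearA c w).toFinset, (accLabel wJ (fun a b : ℕ => decide (a < 6 ∧ b < 6)) (Array.ofFn fun p : Fin 9 => foldW w p) (RbA b) (hessOf (RpA b) true) true ⟨true, 0, 0⟩).pen6) + ∑ b ∈ (nearB c w).toFinset, (accLabel wJ (fun _ _ : ℕ => true) (Array.ofFn fun p : Fin 9 => foldW w p) (RbB b) (hessOf (RpB b) false) false ⟨true, 0, 0⟩).pen6 := by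
    rw [hpen6, List.sum_toFinset _ (nearA_nodup c w), List.sum_toFinset _ (nearB_nodup c w)]
    exact congrArg₂ (· + ·) (congrArg List.sum (List.map_congr_left fun b hb => by simp only [hRbA b hb, hRpA b hb]))
      (congrArg List.sum (List.map_congr_left fun b hb => by simp only [hRbB b hb, hRpB b hb]))
  have ep0R : (((passJ c w (Array.ofFn fun p : Fin 9 => foldW w p) (nearA c w) (nearB c w)).pen0 : ℤ) : ℝ) = (∑ b ∈ (nearA c w).toFinset, (((accLabel wJ (fun a b : ℕ => decide (a < 6 ∧ b < 6)) (Array.ofFn fun p : Fin 9 => foldW w p) (RbA b) (hessOf (RpA b) true) true ⟨true, 0, 0⟩).pen0 : ℤ) : ℝ)) + ∑ b ∈ (nearB c w).toFinset, (((accLabel wJ (fun _ _ : ℕ => true) (Array.ofFn fun p : Fin 9 => foldW w p) (RbB b) (hessOf (RpB b) false) false ⟨true, 0, 0⟩).pen0 : ℤ) : ℝ) := by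
    rw [ep0]; push_cast; rfl
  have ep6R : (((passJ c w (Array.ofFn fun p : Fin 9 => foldW w p) (nearA c w) (nearB c w)).pen6 : ℤ) : ℝ) = (∑ b ∈ (nearA c w).toFinset, (((accLabel wJ (fun a b : ℕ => decide (a < 6 ∧ b < 6)) (Array.ofFn fun p : Fin 9 => foldW w p) (RbA b) (hessOf (RpA b) true) true ⟨true, 0, 0⟩).pen6 : ℤ) : ℝ)) + ∑ b ∈ (nearB c w).toFinset, (((accLabel wJ (fun _ _ : ℕ => true) (Array.ofFn fun p : Fin 9 => foldW w p) (RbB b) (hessOf (RpB b) false) false ⟨true, 0, 0⟩).pen6 : ℤ) : ℝ) := by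
    rw [ep6]; push_cast; rfl
  -- label counts
  have hcardA : (((nearA c w).toFinset.card : ℕ) : ℝ) ≤ 3375 := by
    exact_mod_cast (List.toFinset_card_le _).trans (length_near_le c w).1
  have hcardB : (((nearB c w).toFinset.card : ℕ) : ℝ) ≤ 3375 := by
    exact_mod_cast (List.toFinset_card_le _).trans (length_near_le c w).2
  -- the charge sums in closed form
  have eQA : (∑ b ∈ (nearA c w).toFinset, 1 / 2 * (((accLabel wJ (fun a b : ℕ => decide (a < 6 ∧ b < 6)) (Array.ofFn fun p : Fin 9 => foldW w p) (RbA b) (hessOf (RpA b) true) true ⟨true, 0, 0⟩).pen0 : ℤ) : ℝ) / ((SC : ℝ) * SC * SC)) +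
      ∑ b ∈ (nearA c w).toFinset, 1 / 6 * ((((accLabel wJ (fun a b : ℕ => decide (a < 6 ∧ b < 6)) (Array.ofFn fun p : Fin 9 => foldW w p) (RbA b) (hessOf (RpA b) true) true ⟨true, 0, 0⟩).pen6 : ℤ) : ℝ) + 729 * SC) / ((SC : ℝ) * SC * SC) =
      1 / 2 * (∑ b ∈ (nearA c w).toFinset, (((accLabel wJ (fun a b : ℕ => decide (a < 6 ∧ b < 6)) (Array.ofFn fun p : Fin 9 => foldW w p) (RbA b) (hessOf (RpA b) true) true ⟨true, 0, 0⟩).pen0 : ℤ) : ℝ)) / ((SC : ℝ) * SC * SC) +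
        1 / 6 * ((∑ b ∈ (nearA c w).toFinset, (((accLabel wJ (fun a b : ℕ => decide (a < 6 ∧ b < 6)) (Array.ofFn fun p : Fin 9 => foldW w p) (RbA b) (hessOf (RpA b) true) true ⟨true, 0, 0⟩).pen6 : ℤ) : ℝ)) + ((nearA c w).toFinset.card : ℕ) * (729 * SC)) / ((SC : ℝ) * SC * SC) := by
    rw [← Finset.sum_div, ← Finset.sum_div, ← Finset.mul_sum, ← Finset.mul_sum, Finset.sum_add_distrib, Finset.sum_const, nsmul_eq_mul]
  have eQB : (∑ b ∈ (nearB c w).toFinset, 1 / 2 * (((accLabel wJ (fun _ _ : ℕ => true) (Array.ofFn fun p : Fin 9 => foldW w p) (RbB b) (hessOf (RpB b) false) false ⟨true, 0, 0⟩).pen0 : ℤ) : ℝ) / ((SC : ℝ) * SC * SC)) +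
      ∑ b ∈ (nearB c w).toFinset, 1 / 6 * ((((accLabel wJ (fun _ _ : ℕ => true) (Array.ofFn fun p : Fin 9 => foldW w p) (RbB b) (hessOf (RpB b) false) false ⟨true, 0, 0⟩).pen6 : ℤ) : ℝ) + 729 * SC) / ((SC : ℝ) * SC * SC) =
      1 / 2 * (∑ b ∈ (nearB c w).toFinset, (((accLabel wJ (fun _ _ : ℕ => true) (Array.ofFn fun p : Fin 9 => foldW w p) (RbB b) (hessOf (RpB b) false) false ⟨true, 0, 0⟩).pen0 : ℤ) : ℝ)) / ((SC : ℝ) * SC * SC) +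
        1 / 6 * ((∑ b ∈ (nearB c w).toFinset, (((accLabel wJ (fun _ _ : ℕ => true) (Array.ofFn fun p : Fin 9 => foldW w p) (RbB b) (hessOf (RpB b) false) false ⟨true, 0, 0⟩).pen6 : ℤ) : ℝ)) + ((nearB c w).toFinset.card : ℕ) * (729 * SC)) / ((SC : ℝ) * SC * SC) := by
    rw [← Finset.sum_div, ← Finset.sum_div, ← Finset.mul_sum, ← Finset.mul_sum, Finset.sum_add_distrib, Finset.sum_const, nsmul_eq_mul]
  rw [eQA] at hsumA
  rw [eQB] at hsumB
  -- (7) everything over `ℝ`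
  push_cast at hc1 hc2 hc3 hc4
  have hineqR : (0 : ℝ) ≤ ((v : ℝ) + ((boxMin ((passP c (nearA c w) (nearB c w)).H.map cen) ((passP c (nearA c w) (nearB c w)).g.map cen) (Array.ofFn fun p : Fin 9 => foldW w p) κ (anchor ((passP c (nearA c w) (nearB c w)).H.map cen) ((passP c (nearA c w) (nearB c w)).g.map cen) (Array.ofFn fun p : Fin 9 => foldW w p) 40) : ℤ) : ℝ) - ((((cdiv ((List.range 9).foldl (fun s k => s + ((passP c (nearA c w) (nearB c w)).g.map rad).getD k 0 * (Array.ofFn fun p : Fin 9 => foldW w p).getD k 0) 0) (SC : ℤ) : ℤ) : ℝ)) + ((cdiv ((List.range 9).foldl (fun s k => (List.range 9).foldl (fun s2 l => s2 + (((passP c (nearA c w) (nearB c w)).H.map rad).getD (9 * k + l) 0) * (Array.ofFn fun p : Fin 9 => foldW w p).getD k 0 * (Array.ofFn fun p : Fin 9 => foldW w p).getD l 0) s) 0) (2 * (SC : ℤ) * (SC : ℤ)) : ℤ) : ℝ)) - ((cdiv (passJ c w (Array.ofFn fun p : Fin 9 => foldW w p) (nearA c w) (nearB c w)).pen6 (6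 * (SC : ℤ) * (SC : ℤ)) : ℤ) : ℝ) - ((cdiv (passJ c w (Array.ofFn fun p : Fin 9 => foldW w p) (nearA c w) (nearB c w)).pen0 (2 * (SC : ℤ) * (SC : ℤ)) : ℤ) : ℝ) - (μ : ℝ)) := by
    exact_mod_cast hineq
  have hSC : (4920750 : ℝ) ≤ SC := by norm_num [SC]
  -- the four penalty terms against the kit's rounded quantities
  have hN1 := (div_le_iff₀ hS).1 hc1
  have hN2 := (div_le_iff₀ (mul_pos (mul_pos (by norm_num) hS) hS : (0 : ℝ) < 2 * (SC : ℝ) * SC)).1 hc2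
  have hN6 := (div_le_iff₀ (mul_pos (mul_pos (by norm_num) hS) hS : (0 : ℝ) < 6 * (SC : ℝ) * SC)).1 hc3
  have hN0 := (div_le_iff₀ (mul_pos (mul_pos (by norm_num) hS) hS : (0 : ℝ) < 2 * (SC : ℝ) * SC)).1 hc4
  have hpen1' : ∑ k ∈ range 9, ((rad ((passP c (nearA c w) (nearB c w)).g.getD k fi0) : ℝ) / SC) * |dispN (U - cenMap c) (ξ - cenShuf c) k| ≤ ((cdiv ((List.range 9).foldl (fun s k => s + ((passP c (nearA c w) (nearB c w)).g.map rad).getD k 0 * (Array.ofFn fun p : Fin 9 => foldW w p).getD k 0) 0) (SC : ℤ) : ℤ) : ℝ) / SC := by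
    refine hpen1.trans ?_
    rw [ec1R, div_le_div_iff₀ (mul_pos hS hS) hS]
    linarith [mul_le_mul_of_nonneg_right hN1 hS.le]
  have hpen2' : ∑ k ∈ range 9, ∑ l ∈ range 9, ((rad ((passP c (nearA c w) (nearB c w)).H.getD (9 * k + l) fi0) : ℝ) / SC) * (|dispN (U - cenMap c) (ξ - cenShuf c) k| * |dispN (U - cenMap c) (ξ - cenShuf c) l|) ≤
      2 * ((cdiv ((List.range 9).foldl (fun s k => (List.range 9).foldl (fun s2 l => s2 + (((passP c (nearA c w) (nearB c w)).H.map rad).getD (9 * k + l) 0) * (Array.ofFn fun p : Fin 9 => foldW w p).getD k 0 * (Array.ofFn fun p : Fin 9 => foldW w p).getD l 0) s) 0) (2 * (SC : ℤ) * (SC : ℤ)) : ℤ) : ℝ) / SC := by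
    refine hpen2.trans ?_
    rw [ec2R, div_le_div_iff₀ hS3 hS]
    linarith [mul_le_mul_of_nonneg_right hN2 hS.le]
  have hQ0 : 1 / 2 * (∑ b ∈ (nearA c w).toFinset, (((accLabel wJ (fun a b : ℕ => decide (a < 6 ∧ b < 6)) (Array.ofFn fun p : Fin 9 => foldW w p) (RbA b) (hessOf (RpA b) true) true ⟨true, 0, 0⟩).pen0 : ℤ) : ℝ)) / ((SC : ℝ) * SC * SC) + 1 / 2 * (∑ b ∈ (nearB c w).toFinset, (((accLabel wJ (fun _ _ : ℕ => true) (Array.ofFn fun p : Fin 9 => foldW w p) (RbB b) (hessOf (RpB b) false) false ⟨true, 0, 0⟩).pen0 : ℤ) : ℝ)) / ((SC : ℝ) * SC * SC) ≤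
      ((cdiv (passJ c w (Array.ofFn fun p : Fin 9 => foldW w p) (nearA c w) (nearB c w)).pen0 (2 * (SC : ℤ) * (SC : ℤ)) : ℤ) : ℝ) / SC := by
    rw [← add_div, ← mul_add, ← ep0R, div_le_div_iff₀ hS3 hS]
    linarith [mul_le_mul_of_nonneg_right hN0 hS.le]
  have hQ6 : 1 / 6 * ((∑ b ∈ (nearA c w).toFinset, (((accLabel wJ (fun a b : ℕ => decide (a < 6 ∧ b < 6)) (Array.ofFn fun p : Fin 9 => foldW w p) (RbA b) (hessOf (RpA b) true) true ⟨true, 0, 0⟩).pen6 : ℤ) : ℝ)) + ((nearA c w).toFinset.card : ℕ) * (729 * SC)) / ((SC : ℝ) * SC * SC) +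
      1 / 6 * ((∑ b ∈ (nearB c w).toFinset, (((accLabel wJ (fun _ _ : ℕ => true) (Array.ofFn fun p : Fin 9 => foldW w p) (RbB b) (hessOf (RpB b) false) false ⟨true, 0, 0⟩).pen6 : ℤ) : ℝ)) + ((nearB c w).toFinset.card : ℕ) * (729 * SC)) / ((SC : ℝ) * SC * SC) ≤
      ((cdiv (passJ c w (Array.ofFn fun p : Fin 9 => foldW w p) (nearA c w) (nearB c w)).pen6 (6 * (SC : ℤ) * (SC : ℤ)) : ℤ) : ℝ) / SC + 1 / SC := by
    rw [← add_div, ← mul_add, ← add_div, div_le_div_iff₀ hS3 hS]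
    have h729 : (0 : ℝ) ≤ 729 * SC := by linarith
    have hA' := mul_le_mul_of_nonneg_right hcardA h729
    have hB' := mul_le_mul_of_nonneg_right hcardB h729
    have hSS := mul_le_mul_of_nonneg_right hSC hS.le
    have hcards : (((nearA c w).toFinset.card : ℕ) : ℝ) * (729 * SC) + (((nearB c w).toFinset.card : ℕ) : ℝ) * (729 * SC) ≤ 6 * SC * SC := by
      linarith [hA', hB', hSS, mul_pos hS hS]
    have h6 := mul_le_mul_of_nonneg_right hN6 hS.le
    have hc' := mul_le_mul_of_nonneg_right hcards hS.le
    rw [ep6R] at h6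
    linarith [h6, hc']
  -- (8) combine
  have e1 : ((μ : ℝ) - 1) / SC = (μ : ℝ) / SC - 1 / SC := by ring
  have e2 : ((v : ℝ) + ((boxMin ((passP c (nearA c w) (nearB c w)).H.map cen) ((passP c (nearA c w) (nearB c w)).g.map cen) (Array.ofFn fun p : Fin 9 => foldW w p) κ (anchor ((passP c (nearA c w) (nearB c w)).H.map cen) ((passP c (nearA c w) (nearB c w)).g.map cen) (Array.ofFn fun p : Fin 9 => foldW w p) 40) : ℤ) : ℝ) - ((((cdiv ((List.range 9).foldl (fun s k => s + ((passP c (nearA c w) (nearB c w)).g.map rad).getD k 0 * (Array.ofFn fun p : Fin 9 => foldW w p).getD k 0) 0) (SC : ℤ) : ℤ) : ℝ)) + ((cdiv ((List.range 9).foldl (fun s k => (List.range 9).foldl (fun s2 l => s2 + (((passP c (nearA c w) (nearB c w)).H.map rad).getD (9 * k + l) 0) * (Array.ofFn fun p : Fin 9 => foldW w p).getD k 0 * (Array.ofFn fun p : Fin 9 => foldW w p).getD l 0) s) 0) (2 * (SC : ℤ) * (SC : ℤ)) : ℤ) : ℝ)) - ((cdiv (passJ c w (Array.ofFn fun p : Fin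 9 => foldW w p) (nearA c w) (nearB c w)).pen6 (6 * (SC : ℤ) * (SC : ℤ)) : ℤ) : ℝ) - ((cdiv (passJ c w (Array.ofFn fun p : Fin 9 => foldW w p) (nearA c w) (nearB c w)).pen0 (2 * (SC : ℤ) * (SC : ℤ)) : ℤ) : ℝ) - (μ : ℝ)) / SC =
      (v : ℝ) / SC + ((boxMin ((passP c (nearA c w) (nearB c w)).H.map cen) ((passP c (nearA c w) (nearB c w)).g.map cen) (Array.ofFn fun p : Fin 9 => foldW w p) κ (anchor ((passP c (nearA c w) (nearB c w)).H.map cen) ((passP c (nearA c w) (nearB c w)).g.map cen) (Array.ofFn fun p : Fin 9 => foldW w p) 40) : ℤ) : ℝ) / SC - ((cdiv ((List.range 9).foldl (fun s k => s + ((passP c (nearA c w) (nearB c w)).g.map rad).getD k 0 * (Array.ofFn fun p : Fin 9 => foldW w p).getD k 0) 0) (SC : ℤ) : ℤ) : ℝ) / SC - ((cdiv ((List.range 9).foldl (fun s k => (List.range 9).foldl (fun s2 l => s2 + (((passP c (nearA c w) (nearB c w)).H.map rad).getD (9 * k + l) 0) * (Array.ofFn fun p : Fin 9 => foldW w p).getD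 k 0 * (Array.ofFn fun p : Fin 9 => foldW w p).getD l 0) s) 0) (2 * (SC : ℤ) * (SC : ℤ)) : ℤ) : ℝ) / SC - ((cdiv (passJ c w (Array.ofFn fun p : Fin 9 => foldW w p) (nearA c w) (nearB c w)).pen6 (6 * (SC : ℤ) * (SC : ℤ)) : ℤ) : ℝ) / SC - ((cdiv (passJ c w (Array.ofFn fun p : Fin 9 => foldW w p) (nearA c w) (nearB c w)).pen0 (2 * (SC : ℤ) * (SC : ℤ)) : ℤ) : ℝ) / SC -
        (μ : ℝ) / SC := by ring
  have hineqR' := div_nonneg hineqR hS.le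
  rw [e2] at hineqR'
  have e3 : 2 * ((cdiv ((List.range 9).foldl (fun s k => (List.range 9).foldl (fun s2 l => s2 + (((passP c (nearA c w) (nearB c w)).H.map rad).getD (9 * k + l) 0) * (Array.ofFn fun p : Fin 9 => foldW w p).getD k 0 * (Array.ofFn fun p : Fin 9 => foldW w p).getD l 0) s) 0) (2 * (SC : ℤ) * (SC : ℤ)) : ℤ) : ℝ) / SC = 2 * (((cdiv ((List.range 9).foldl (fun s k => (List.range 9).foldl (fun s2 l => s2 + (((passP c (nearA c w) (nearB c w)).H.map rad).getD (9 * k + l) 0) * (Array.ofFn fun p : Fin 9 => foldW w p).getD k 0 * (Array.ofFn fun p : Fin 9 => foldW w p).getD l 0) s) 0) (2 * (SC : ℤ) * (SC : ℤ)) : ℤ) : ℝ) / SC) := by ring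
  rw [e3] at hpen2'
  rw [e1]
  linarith [hsumA, hsumB, hT1, hlin, hquad, hbm, hpen1', hpen2', hQ0, hQ6, hineqR']

end Summit.AtomisticToContinuum.Crystallization.Theorems.FrustratedLawDichotomyStrainedPatchHomValueT2Kit
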